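import Summits.KontsevichZagierPeriods.KontsevichZagierPeriods.Theorems.RootDecompRelativeModAbsoluteCylLogSplitP21

/-! # `RootDecompRelativeModAbsoluteCylLogSplitP22` — part 22/25 of the mechanical ≤330-line split of `CylLogSplit.lean`
(split by the decomp-kz census seat for landing; mathematics unchanged; part 22 continues part 21). -/

noncomputable section
open Set MeasureTheory Filter Topology
open scoped BigOperators
open Literature.NumberTheory.Transcendental Literature.ModelTheory.ExponentialFields

namespace Summit.KontsevichZagierPeriods.RootDecompRelativeModAbsolute.Rung30571

namespace RegularisedLogLayer

namespace CylLog
variable {b : ℕ}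

/-- Composite form used in D2: `x ↦ c x · ∫₀¹ θ^M/(1+θκ(x)) dθ` is continuous on a cell where `c, κ` are continuous and
`κ > −1`. -/
theorem continuousOn_coeff_mul_fibreIntegral {b M : ℕ} {C : Set (Fin b → ℝ)} {c κ : (Fin b → ℝ) → ℝ}
    (hc : ContinuousOn c C) (hκ : ContinuousOn κ C) (hκ1 : ∀ x ∈ C, -1 < κ x) :
    ContinuousOn (fun x => c x * ∫ θ in Set.Ioo (0:ℝ) 1, θ ^ M / (1 + θ * κ x)) C :=
  hc.mul ((continuousOn_fibreIntegral M).comp hκ fun x hx => hκ1 x hx)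

/-- **D2 (a.e. ⇒ pointwise on open cells).**  A function continuous on an open cell and vanishing a.e. there vanishes
there. -/
theorem forall_eq_zero_of_ae {b : ℕ} {C : Set (Fin b → ℝ)} (hCo : IsOpen C) {F : (Fin b → ℝ) → ℝ}
    (hF : ContinuousOn F C) (h : ∀ᵐ x, x ∈ C → F x = 0) : ∀ x ∈ C, F x = 0 := by
  have h' : F =ᵐ[volume.restrict C] fun _ => 0 := (ae_restrict_iff' hCo.measurableSet).mpr h
  exact Measure.eqOn_open_of_ae_eq h' hCo hF continuousOn_const

/-- **Closed form of the fibre integral (the D3 currency conversion `∫ ↦ log`).**  For `κ ≠ 0`, `−1 < κ`: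
`∫₀¹ θ^M/(1+θκ) dθ = (polyLog M (1+κ) + (−1)^M · log (1+κ)) / κ^(M+1)` (substitution `t = 1 + κθ` +
`integral_reg_kernel`). -/
theorem fibreIntegral_closed_form (M : ℕ) {κ : ℝ} (hκ : κ ≠ 0) (hκ1 : -1 < κ) :
    ∫ θ in Set.Ioo (0:ℝ) 1, θ ^ M / (1 + θ * κ) =
      (polyLog M (1 + κ) + (-1) ^ M * Real.log (1 + κ)) / κ ^ (M + 1) := by
  set ψ : ℝ → ℝ := fun t => (t - 1) ^ M / t with hψ
  have hpt : ∀ θ : ℝ, κ * (ψ (κ * θ + 1) / κ ^ (M + 1)) = θ ^ M / (1 + θ * κ) := by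
    intro θ
    show κ * (((κ * θ + 1 - 1) ^ M / (κ * θ + 1)) / κ ^ (M + 1)) = θ ^ M / (1 + θ * κ)
    rw [add_sub_cancel_right, mul_pow, pow_succ]
    by_cases hden : 1 + θ * κ = 0
    · have h0 : κ * θ + 1 = 0 := by linarith
      rw [h0, hden]
      simp
    · have hden2 : κ * θ + 1 ≠ 0 := fun h => hden (by linarith)
      rw [show (1 : ℝ) + θ * κ = κ * θ + 1 by ring]
      field_simp
  have h1 : ∫ θ in Set.Ioo (0:ℝ) 1, θ ^ M / (1 + θ * κ) = ∫ θ in (0:ℝ)..1, θ ^ M / (1 + θ * κ) := by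
    rw [intervalIntegral.integral_of_le zero_le_one, integral_Ioc_eq_integral_Ioo]
  have h3 : κ * ∫ θ in (0:ℝ)..1, ψ (κ * θ + 1) = ∫ t in κ * 0 + 1..κ * 1 + 1, ψ t :=
    intervalIntegral.mul_integral_comp_mul_add κ 1
  have h4 : ∫ t in (1:ℝ)..1 + κ, ψ t = polyLog M (1 + κ) + (-1) ^ M * Real.log (1 + κ) := by
    rw [hψ, integral_reg_kernel M one_pos (by linarith)]
    simp [polyLog_one]
  rw [h1]
  calc ∫ θ in (0:ℝ)..1, θ ^ M / (1 + θ * κ) = ∫ θ in (0:ℝ)..1, κ * (ψ (κ * θ + 1) / κ ^ (M + 1)) :=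
        intervalIntegral.integral_congr fun θ _ => (hpt θ).symm
    _ = κ * ∫ θ in (0:ℝ)..1, ψ (κ * θ + 1) / κ ^ (M + 1) := intervalIntegral.integral_const_mul κ _
    _ = κ * ((∫ θ in (0:ℝ)..1, ψ (κ * θ + 1)) / κ ^ (M + 1)) := by rw [intervalIntegral.integral_div]
    _ = (κ * ∫ θ in (0:ℝ)..1, ψ (κ * θ + 1)) / κ ^ (M + 1) := by ring
    _ = (∫ t in (1:ℝ)..1 + κ, ψ t) / κ ^ (M + 1) := by
        rw [h3]; simp only [mul_zero, zero_add, mul_one, add_comm]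
    _ = (polyLog M (1 + κ) + (-1) ^ M * Real.log (1 + κ)) / κ ^ (M + 1) := by rw [h4]

/-- The `κ ≡ 0` value: `∫₀¹ θ^M dθ = 1/(M+1)`. -/
theorem fibreIntegral_zero (M : ℕ) : ∫ θ in Set.Ioo (0:ℝ) 1, θ ^ M / (1 + θ * 0) = 1 / ((M : ℝ) + 1) := by
  simp only [mul_zero, add_zero, div_one]
  rw [← integral_Ioc_eq_integral_Ioo, ← intervalIntegral.integral_of_le zero_le_one, integral_pow]
  simp

/-! ### §3z D3 CURRENCY CONVERSION: on a cell with a fixed κ-sign pattern the pointwise integral identity IS a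
ℚ-semialgebraic log-linear identity `Σ h_i log W_i = g` of the shape consumed by `LogStructure`, and `LogStructure`
applied to it — PROVED -/

/-- The log-coefficient of index `i` on a cell with pattern `s` (`s i`: `κ_i ≠ 0` there; `¬ s i`: `κ_i ≡ 0`). -/
def logCoef {b q : ℕ} (s : Fin q → Bool) (c κ : Fin q → (Fin b → ℝ) → ℝ) (M : Fin q → ℕ) (i : Fin q)
    (x : Fin b → ℝ) : ℝ :=
  if s i then (-1) ^ M i * c i x / κ i x ^ (M i + 1) else 0

/-- The polynomial (ℚ-semialgebraic) part of index `i`. -/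
def polyPart {b q : ℕ} (s : Fin q → Bool) (c κ : Fin q → (Fin b → ℝ) → ℝ) (M : Fin q → ℕ) (i : Fin q)
    (x : Fin b → ℝ) : ℝ :=
  if s i then c i x * polyLog (M i) (1 + κ i x) / κ i x ^ (M i + 1) else c i x / ((M i : ℝ) + 1)

/-- Auxiliary step `term_eq_polyPart_add_logCoef`. [bookkeeping] -/
theorem term_eq_polyPart_add_logCoef {b q : ℕ} (s : Fin q → Bool) (c κ : Fin q → (Fin b → ℝ) → ℝ)
    (M : Fin q → ℕ) {C : Set (Fin b → ℝ)} (hs : ∀ i, s i = true → ∀ x ∈ C, κ i x ≠ 0)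
    (hs' : ∀ i, s i = false → ∀ x ∈ C, κ i x = 0) (hκ1 : ∀ i, ∀ x ∈ C, -1 < κ i x) (i : Fin q)
    {x : Fin b → ℝ} (hx : x ∈ C) :
    c i x * ∫ θ in Set.Ioo (0:ℝ) 1, θ ^ M i / (1 + θ * κ i x) =
      polyPart s c κ M i x + logCoef s c κ M i x * Real.log (1 + κ i x) := by
  cases h : s i
  · have h0 := hs' i h x hx
    simp only [polyPart, logCoef, h, h0, fibreIntegral_zero, Bool.false_eq_true, ↓reduceIte, zero_mul, add_zero]
    ring
  · have hne := hs i h x hx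
    simp only [polyPart, logCoef, h, fibreIntegral_closed_form (M i) hne (hκ1 i x hx), if_true]
    ring

/-- **Integral identity ⇒ log-linear identity** on a cell with a fixed κ-sign pattern. -/
theorem logForm_of_integralForm {b q : ℕ} {C : Set (Fin b → ℝ)} (s : Fin q → Bool)
    {a₀ : (Fin b → ℝ) → ℝ} {c κ : Fin q → (Fin b → ℝ) → ℝ} {M : Fin q → ℕ}
    (hs : ∀ i, s i = true → ∀ x ∈ C, κ i x ≠ 0) (hs' : ∀ i, s i = false → ∀ x ∈ C, κ i x = 0)
    (hκ1 : ∀ i, ∀ x ∈ C, -1 < κ i x)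
    (hid : ∀ x ∈ C, a₀ x + ∑ i, c i x * ∫ θ in Set.Ioo (0:ℝ) 1, θ ^ M i / (1 + θ * κ i x) = 0) :
    ∀ x ∈ C, ∑ i, logCoef s c κ M i x * Real.log (1 + κ i x) = -(a₀ x + ∑ i, polyPart s c κ M i x) := by
  intro x hx
  have h := hid x hx
  rw [Finset.sum_congr rfl fun i _ => term_eq_polyPart_add_logCoef s c κ M hs hs' hκ1 i hx,
    Finset.sum_add_distrib] at h
  linarith

/-- Auxiliary step `isSemialgebraicFunOn_logCoef`. [bookkeeping] -/
theorem isSemialgebraicFunOn_logCoef {b q : ℕ} {C : Set (Fin b → ℝ)} (hC : IsSemialgebraic ℚ C)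
    (s : Fin q → Bool) {c κ : Fin q → (Fin b → ℝ) → ℝ} (M : Fin q → ℕ)
    (hc : ∀ i, IsSemialgebraicFunOn ℚ C (c i)) (hκ : ∀ i, IsSemialgebraicFunOn ℚ C (κ i))
    (hs : ∀ i, s i = true → ∀ x ∈ C, κ i x ≠ 0) (i : Fin q) :
    IsSemialgebraicFunOn ℚ C (logCoef s c κ M i) := by
  cases h : s i
  · exact (isSemialgebraicFunOn_ratCast hC 0).congr fun x _ => by simp [logCoef, h]
  · have hnum : IsSemialgebraicFunOn ℚ C (fun x => (-1) ^ M i * c i x) :=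
      (IsSemialgebraicFunOn.mul_holds (isSemialgebraicFunOn_ratCast hC ((-1) ^ M i)) (hc i)).congr
        fun x _ => by simp only [Pi.mul_apply]; push_cast; ring
    exact (hnum.div (isSemialgebraicFunOn_pow' hC (hκ i) (M i + 1)) fun x hx => pow_ne_zero _ (hs i h x hx)).congr
      fun x _ => by simp [logCoef, h]

/-- Auxiliary step `isSemialgebraicFunOn_polyPart`. [bookkeeping] -/
theorem isSemialgebraicFunOn_polyPart {b q : ℕ} {C : Set (Fin b → ℝ)} (hC : IsSemialgebraic ℚ C)
    (s : Fin q → Bool) {c κ : Fin q → (Fin b → ℝ) → ℝ} (M : Fin q → ℕ)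
    (hc : ∀ i, IsSemialgebraicFunOn ℚ C (c i)) (hκ : ∀ i, IsSemialgebraicFunOn ℚ C (κ i))
    (hs : ∀ i, s i = true → ∀ x ∈ C, κ i x ≠ 0) (i : Fin q) :
    IsSemialgebraicFunOn ℚ C (polyPart s c κ M i) := by
  cases h : s i
  · exact (IsSemialgebraicFunOn.mul_holds (hc i) (isSemialgebraicFunOn_ratCast hC (((M i : ℚ) + 1)⁻¹))).congr
      fun x _ => by simp only [polyPart, h]; push_cast; simp [div_eq_mul_inv]
  · have h1 : IsSemialgebraicFunOn ℚ C (fun x => 1 + κ i x) :=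
      (IsSemialgebraicFunOn.add_holds (isSemialgebraicFunOn_ratCast hC 1) (hκ i)).congr fun x _ => by simp
    have hnum : IsSemialgebraicFunOn ℚ C (fun x => c i x * polyLog (M i) (1 + κ i x)) :=
      IsSemialgebraicFunOn.mul_holds (hc i) (isSemialgebraicFunOn_polyLog_comp hC h1 (M i))
    exact (hnum.div (isSemialgebraicFunOn_pow' hC (hκ i) (M i + 1)) fun x hx => pow_ne_zero _ (hs i h x hx)).congr
      fun x _ => by simp [polyPart, h]

/-- Auxiliary step `isSemialgebraicFunOn_logRhs`. [bookkeeping] -/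
theorem isSemialgebraicFunOn_logRhs {b q : ℕ} {C : Set (Fin b → ℝ)} (hC : IsSemialgebraic ℚ C)
    (s : Fin q → Bool) {a₀ : (Fin b → ℝ) → ℝ} {c κ : Fin q → (Fin b → ℝ) → ℝ} (M : Fin q → ℕ)
    (ha₀ : IsSemialgebraicFunOn ℚ C a₀)
    (hc : ∀ i, IsSemialgebraicFunOn ℚ C (c i)) (hκ : ∀ i, IsSemialgebraicFunOn ℚ C (κ i))
    (hs : ∀ i, s i = true → ∀ x ∈ C, κ i x ≠ 0) :
    IsSemialgebraicFunOn ℚ C (fun x => -(a₀ x + ∑ i, polyPart s c κ M i x)) :=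
  (IsSemialgebraicFunOn.add_holds ha₀ (KZ.isSemialgebraicFunOn_finset_sum Finset.univ hC fun i _ =>
    isSemialgebraicFunOn_polyPart hC s M hc hκ hs i)).neg

/-- **D3 — `LogStructure` APPLIED on a cell with a fixed κ-sign pattern (PROVED modulo the hypothesis
`LogStructure`, a TREE theorem carried by statement).**  Output: the finite open partition of the cell up to a null
set, on each piece the polynomial parts summing to `−a₀` (`a₀ + Σ polyPart = 0`) and the log-coefficients
`logCoef i = (−1)^{M_i} c_i/κ_i^{M_i+1}` spanned by EXACT integer relations `∏ (1+κ_i)^{f r i} = 1` with ℚ-sa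
coefficients `q r` — the data consumed by §3u–§3x (restriction, orientation) and §3w (D7 in the ℤ-currency). -/
theorem logStructure_cells (hLS : LogStructure) {b q : ℕ} {C : Set (Fin b → ℝ)} (hC : IsSemialgebraic ℚ C)
    (s : Fin q → Bool) {a₀ : (Fin b → ℝ) → ℝ} {c κ : Fin q → (Fin b → ℝ) → ℝ} {M : Fin q → ℕ}
    (ha₀ : IsSemialgebraicFunOn ℚ C a₀)
    (hc : ∀ i, IsSemialgebraicFunOn ℚ C (c i)) (hκ : ∀ i, IsSemialgebraicFunOn ℚ C (κ i))
    (hs : ∀ i, s i = true → ∀ x ∈ C, κ i x ≠ 0) (hs' : ∀ i, s i = false → ∀ x ∈ C, κ i x = 0)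
    (hκ1 : ∀ i, ∀ x ∈ C, -1 < κ i x)
    (hid : ∀ x ∈ C, a₀ x + ∑ i, c i x * ∫ θ in Set.Ioo (0:ℝ) 1, θ ^ M i / (1 + θ * κ i x) = 0) :
    ∃ (N : ℕ) (D : Fin N → Set (Fin b → ℝ)),
      (∀ e, IsSemialgebraic ℚ (D e) ∧ IsOpen (D e) ∧ D e ⊆ C) ∧
      Pairwise (Function.onFun Disjoint D) ∧ volume (C \ ⋃ e, D e) = 0 ∧
      ∀ e, (∀ x ∈ D e, a₀ x + ∑ i, polyPart s c κ M i x = 0) ∧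
        ∃ (R : ℕ) (f : Fin R → Fin q → ℤ) (qq : Fin R → (Fin b → ℝ) → ℝ),
          (∀ r, IsSemialgebraicFunOn ℚ (D e) (qq r)) ∧ (∀ r, ∀ x ∈ D e, ∏ i, (1 + κ i x) ^ (f r i) = 1) ∧
          (∀ i, ∀ x ∈ D e, logCoef s c κ M i x = ∑ r, qq r x * (f r i : ℝ)) := by
  have hW : ∀ i, IsSemialgebraicFunOn ℚ C (fun x => 1 + κ i x) := fun i =>
    (IsSemialgebraicFunOn.add_holds (isSemialgebraicFunOn_ratCast hC 1) (hκ i)).congr fun x _ => by simp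
  obtain ⟨N, D, hD, hdisj, hnull, hcell⟩ := hLS b q C (logCoef s c κ M) (fun i x => 1 + κ i x)
    (fun x => -(a₀ x + ∑ i, polyPart s c κ M i x)) hC (isSemialgebraicFunOn_logCoef hC s M hc hκ hs) hW
    (fun i x hx => by linarith [hκ1 i x hx]) (isSemialgebraicFunOn_logRhs hC s M ha₀ hc hκ hs)
    (logForm_of_integralForm s hs hs' hκ1 hid)
  refine ⟨N, D, hD, hdisj, hnull, fun e => ⟨fun x hx => ?_, (hcell e).2⟩⟩
  have h := (hcell e).1 x hx
  linarith

/-! ### §3aa (R1) THE `BoundaryRigidity` FEED — TYPED, and PROVED from `BoundaryRigidity` BY NAME (+ §3n)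
The tame part of the glue at `κ → ∞` ends is lowered to `M = 0` (pure-log cells).  The interface the assembly D8 needs
is exactly: σ-oriented pure-log cells `U_i` (`σ i`: `[band C 1 W_i, h_i/t]`, `W_i ≥ 1`; `¬σ i`: `[band C W_i 1, h_i/t]`,
`0 < W_i ≤ 1`) whose coefficients satisfy `Σ h_i log W_i = 0` on `C` with each `h_i log W_i ∈ L¹(C)` give
`Σ_i (±1)•[U_i] ∈ KZ.relations`.  This is `BoundaryRigidity` with `g = [C, 0]` after re-orienting the `W ≤ 1` cells by
the scaling `t = W s` (§3n) and an integrand sign flip; the re-oriented cells are shown honest from the base bound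
(`∫_1^w |h|/t dt = |h| log w`). -/

/-- Fibre bound for the pure-log kernel on `[1, w]`, `w ≥ 1`: `∫⁻_{[1,w]} ‖h/t‖ ≤ ‖|h|·log w‖`. -/
theorem lintegral_logKernel_le (q : ℝ) {w : ℝ} (hw : 1 ≤ w) :
    ∫⁻ t in Icc 1 w, ‖q / t‖ₑ ≤ ‖|q| * Real.log w‖ₑ := by
  have hcont : ContinuousOn (fun t : ℝ => q / t) (Icc 1 w) :=
    continuousOn_const.div continuousOn_id fun t ht => (by linarith [ht.1] : (0:ℝ) < t).ne'
  have hg_int : IntegrableOn (fun t : ℝ => q / t) (Icc 1 w) := hcont.integrableOn_compact isCompact_Icc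
  have hL : ∫⁻ t in Icc 1 w, ‖q / t‖ₑ = ENNReal.ofReal (∫ t in Icc 1 w, ‖q / t‖) :=
    (ofReal_integral_norm_eq_lintegral_enorm hg_int).symm
  have hK0 : 0 ≤ |q| * Real.log w := mul_nonneg (abs_nonneg _) (Real.log_nonneg hw)
  rw [hL, Real.enorm_eq_ofReal hK0]
  refine ENNReal.ofReal_le_ofReal (le_of_eq ?_)
  have heq : EqOn (fun t : ℝ => ‖q / t‖) (fun t => |q| * t⁻¹) (Icc 1 w) := fun t ht => by
    show ‖q / t‖ = |q| * t⁻¹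
    rw [Real.norm_eq_abs, abs_div, abs_of_pos (by linarith [ht.1] : (0:ℝ) < t), div_eq_mul_inv]
  rw [setIntegral_congr_fun measurableSet_Icc heq, integral_Icc_eq_integral_Ioc,
    ← intervalIntegral.integral_of_le hw, intervalIntegral.integral_const_mul,
    integral_inv_of_pos one_pos (by linarith), div_one]

/-- **Honesty of a pure-log cell from the base bound** (`W ≥ 1`): for `ℚ`-semialgebraic `h, W` on `G` with
`h·log W ∈ L¹(G)`, the cell `[band G 1 W, h/t]` EXISTS as an honest representation with exactly this integrand. -/
theorem exists_logRep_of_integrableOn_log {b : ℕ} {G : Set (Fin b → ℝ)} {h W : (Fin b → ℝ) → ℝ}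
    (hG : IsSemialgebraic ℚ G) (hh : IsSemialgebraicFunOn ℚ G h) (hW : IsSemialgebraicFunOn ℚ G W)
    (hW1 : ∀ x ∈ G, 1 ≤ W x) (hint : IntegrableOn (fun x => h x * Real.log (W x)) G) :
    ∃ R : KZ.IntegralRep (b + 1), R.domain = KZlog.band G (fun _ => 1) W ∧
      R.integrand = fun z => h (Fin.init z) / z (Fin.last b) := by
  have h1sa : IsSemialgebraicFunOn ℚ G (fun _ => (1:ℝ)) :=
    (isSemialgebraicFunOn_ratCast hG 1).congr fun _ _ => by simp
  have hbsa : IsSemialgebraic ℚ (KZlog.band G (fun _ => (1:ℝ)) W) := KZlog.isSemialgebraic_band h1sa hW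
  have hGm : MeasurableSet G := hG.measurableSet_holds
  have hBm : MeasurableSet (KZlog.band G (fun _ => (1:ℝ)) W) := hbsa.measurableSet_holds
  have hband_sub : KZlog.band G (fun _ => (1:ℝ)) W ⊆ {z : Fin (b + 1) → ℝ | Fin.init z ∈ G} :=
    fun z hz => hz.1
  have hqI : IsSemialgebraicFunOn ℚ (KZlog.band G (fun _ => (1:ℝ)) W) (fun z => h (Fin.init z)) :=
    hh.comp_init.mono hband_sub hbsa
  have hsI : IsSemialgebraicFunOn ℚ (KZlog.band G (fun _ => (1:ℝ)) W) (fun z => z (Fin.last b)) :=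
    isSemialgebraicFunOn_apply hbsa (Fin.last b)
  have hs0 : ∀ z ∈ KZlog.band G (fun _ => (1:ℝ)) W, z (Fin.last b) ≠ 0 := fun z hz => by
    have h1 : (1:ℝ) ≤ z (Fin.last b) := hz.2.1
    exact (by linarith : (0:ℝ) < z (Fin.last b)).ne'
  have hRsa : IsSemialgebraicFunOn ℚ (KZlog.band G (fun _ => (1:ℝ)) W)
      (fun z => h (Fin.init z) / z (Fin.last b)) := IsSemialgebraicFunOn.div hqI hsI hs0
  have hKn : IntegrableOn (fun x => ‖h x * Real.log (W x)‖) G := hint.norm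
  have hK : IntegrableOn (fun x => |h x| * Real.log (W x)) G :=
    hKn.congr_fun (fun x hx => by
      show ‖h x * Real.log (W x)‖ = |h x| * Real.log (W x)
      rw [Real.norm_eq_abs, abs_mul, abs_of_nonneg (Real.log_nonneg (hW1 x hx))]) hGm
  have hRint : IntegrableOn (fun z : Fin (b + 1) → ℝ => h (Fin.init z) / z (Fin.last b))
      (KZlog.band G (fun _ => (1:ℝ)) W) := by
    refine KZlog.integrableOn_band_of_lintegral_fibre_le hGm (a := fun _ => (1:ℝ)) (b := W) hBm
      (fun x t => KZlog.snoc_mem_band) (KZ.aestronglyMeasurable_of_isSemialgebraicFunOn hRsa hBm)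
      (K := fun x => |h x| * Real.log (W x)) (fun x hx => ?_) hK
    simp only [Fin.init_snoc, Fin.snoc_last]
    exact lintegral_logKernel_le (h x) (hW1 x hx)
  exact ⟨{ domain := KZlog.band G (fun _ => (1:ℝ)) W
           integrand := fun z => h (Fin.init z) / z (Fin.last b)
           isSemialgebraic_domain := hbsa
           isSemialgebraicFunOn_integrand := hRsa
           integrableOn := hRint }, rfl, rfl⟩

end CylLog
end RegularisedLogLayer
end Summit.KontsevichZagierPeriods.RootDecompRelativeModAbsolute.Rung30571
end
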